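import Mathlib
import Literature.Analysis.FunctionSpaces.TorusTrigPoly
import Literature.Analysis.FunctionSpaces.TorusDirichletKernel
import Summits.AnomalousDissipation.AnomalousDissipation.Theorems.TaylorCertificatesPacketLemmaSpectrum
import Summits.AnomalousDissipation.AnomalousDissipation.Theorems.TaylorCertificatesPacketLemmaStrain
import HarnessLib

/-!
# Route TaylorCertificates — `PacketLemma`, helper 7: pointwise algebra of the packet and the oscillatory terms

Finite-dimensional and spectral bookkeeping for the two estimates of
`TaylorCertificatesPacketLemmaEstimates` in the proof of
`Summit.AnomalousDissipation.AnomalousDissipation.Theses.TaylorCertificates.PacketLemma`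
(item stmt-AnomalousDissipation-14032). With the packet written pointwise as `w = m P + r`,
`m = 2π Re(e_p ψ)` (so `m² = 2π²ψ²(1 + Re e_p²)`, `|m| ≤ 2π|ψ|`) and `‖r‖ ≤ ‖U‖`:

* `inner_map_add_le`, `inner_packet_pointwise_le` — for a linear map `A` whose quadratic form is
  bounded by `s` on the unit sphere,
  `⟪w, Aw⟫ ≤ 2π²ψ²⟪P,AP⟫ + 2π²ψ²⟪P,AP⟫ Re e_p² + 2πs‖P‖(4πnψ² + ‖U‖²/(4πn)) + s‖U‖²`
  (polarisation `abs_inner_add_inner_le` and AM–GM);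
* `norm_smul_add_sq_bounds`, `norm_packet_pointwise_bounds` — the corresponding two-sided
  bounds for `‖w‖²`;
* `integral_envelope_sq_oscillatory_eq_zero` — `∫ ψ² G Re(e_p²) = 0 = ∫ ψ² Re(e_p²)` when
  `ψ` has spectrum in `Ω_M`, `G` in `Ω_D` and `|2pᵢ| > 2M + D` for some `i`
  (`spec_integral_eq_zero`: the spectrum sits in `Ω_{2M+D} + 2p ∌ 0`).

No definitions, no named facts.
-/

noncomputable section

open MeasureTheory UnitAddTorus Complex Real
open scoped ComplexConjugate Pointwise

namespace Summit.AnomalousDissipation.AnomalousDissipation.Theorems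

-- the mandated namespace `Summit.<Summit>.<Problem>.Theorems` repeats `AnomalousDissipation` (single-problem summit)
set_option linter.dupNamespace false

open Literature.Analysis.FunctionSpaces Literature.Analysis.FunctionSpaces.Torus

/-! ### Small algebraic lemmas -/

/-- The characters of `T^d` have modulus one pointwise. [folklore] -/
theorem norm_mFourier_apply {d : Type*} [Fintype d] (k : d → ℤ) (x : UnitAddTorus d) :
    ‖(mFourier k x : ℂ)‖ = 1 := by
  change ‖∏ i, (fourier (k i) (x i) : ℂ)‖ = 1
  rw [norm_prod]
  exact Finset.prod_eq_one fun i _ => by rw [fourier_apply, Circle.norm_coe]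

/-- `cos² = (1 + cos 2·)/2` in complex dress: `(Re z)² = (1 + Re z²)/2` for `|z| = 1`. [folklore] -/
theorem re_sq_eq_of_norm_eq_one {z : ℂ} (hz : ‖z‖ = 1) : z.re ^ 2 = (1 + (z ^ 2).re) / 2 := by
  have h : z.re ^ 2 + z.im ^ 2 = 1 := by
    have := Complex.sq_norm z
    rw [hz, Complex.normSq_apply] at this
    nlinarith [this]
  rw [sq, sq] at h ⊢
  simp only [Complex.mul_re]
  linarith

/-- **Quadratic form of a sum**: for a linear map whose quadratic form is bounded by `s` on the
unit sphere, `⟪mP + r, A(mP + r)⟫ ≤ m² ⟪P, AP⟫ + 2 s |m| ‖P‖ ‖r‖ + s ‖r‖²`. [folklore] -/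
theorem inner_map_add_le {E : Type*} [NormedAddCommGroup E] [InnerProductSpace ℝ E]
    (A : E →L[ℝ] E) {s : ℝ} (hA : ∀ η : E, ‖η‖ = 1 → |inner ℝ η (A η)| ≤ s) (m : ℝ) (P r : E) :
    inner ℝ (m • P + r) (A (m • P + r)) ≤
      m ^ 2 * inner ℝ P (A P) + 2 * s * |m| * ‖P‖ * ‖r‖ + s * ‖r‖ ^ 2 := by
  have hexp : inner ℝ (m • P + r) (A (m • P + r)) =
      m ^ 2 * inner ℝ P (A P) + m * (inner ℝ P (A r) + inner ℝ r (A P)) + inner ℝ r (A r) := by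
    simp only [map_add, map_smul, inner_add_left, inner_add_right, inner_smul_left, inner_smul_right,
      conj_trivial]
    ring
  rw [hexp]
  have h1 : m * (inner ℝ P (A r) + inner ℝ r (A P)) ≤ 2 * s * |m| * ‖P‖ * ‖r‖ := by
    have h := abs_inner_add_inner_le A hA P r
    have : m * (inner ℝ P (A r) + inner ℝ r (A P)) ≤ |m| * |inner ℝ P (A r) + inner ℝ r (A P)| := by
      rw [← abs_mul]; exact le_abs_self _
    refine this.trans ?_
    calc |m| * |inner ℝ P (A r) + inner ℝ r (A P)| ≤ |m| * (2 * s * ‖P‖ * ‖r‖) :=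
          mul_le_mul_of_nonneg_left h (abs_nonneg m)
      _ = 2 * s * |m| * ‖P‖ * ‖r‖ := by ring
  have h2 : inner ℝ r (A r) ≤ s * ‖r‖ ^ 2 := (le_abs_self _).trans (inner_self_le_of_unit_bound A hA r)
  linarith

/-- **Norm of a sum, two-sided**: `m²‖P‖² - 2|m|‖P‖‖r‖ ≤ ‖mP + r‖² ≤ m²‖P‖² + 2|m|‖P‖‖r‖ + ‖r‖²`. [folklore] -/
theorem norm_smul_add_sq_bounds {E : Type*} [NormedAddCommGroup E] [InnerProductSpace ℝ E]
    (m : ℝ) (P r : E) :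
    m ^ 2 * ‖P‖ ^ 2 - 2 * |m| * ‖P‖ * ‖r‖ ≤ ‖m • P + r‖ ^ 2 ∧
      ‖m • P + r‖ ^ 2 ≤ m ^ 2 * ‖P‖ ^ 2 + 2 * |m| * ‖P‖ * ‖r‖ + ‖r‖ ^ 2 := by
  have hexp : ‖m • P + r‖ ^ 2 = m ^ 2 * ‖P‖ ^ 2 + 2 * (m * inner ℝ P r) + ‖r‖ ^ 2 := by
    rw [norm_add_sq_real, norm_smul, inner_smul_left, conj_trivial, mul_pow, Real.norm_eq_abs, sq_abs]
  have hcs : |m * inner ℝ P r| ≤ |m| * ‖P‖ * ‖r‖ := by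
    rw [abs_mul, mul_assoc]
    exact mul_le_mul_of_nonneg_left (abs_real_inner_le_norm P r) (abs_nonneg m)
  have h1 := neg_abs_le (m * inner ℝ P r)
  have h2 := le_abs_self (m * inner ℝ P r)
  constructor <;> nlinarith [sq_nonneg ‖r‖]

/-- Pointwise AM–GM in the form used for the cross terms:
`2 |ψ| ‖U‖ ≤ 4πn ψ² + ‖U‖²/(4πn)` for `n > 0`. [folklore] -/
theorem two_mul_abs_mul_le {ψ U n : ℝ} (hn : 0 < n) :
    2 * |ψ| * U ≤ 4 * π * n * ψ ^ 2 + U ^ 2 / (4 * π * n) := by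
  have hl : 0 < 4 * π * n := by positivity
  have h : 0 ≤ (4 * π * n * |ψ| - U) ^ 2 / (4 * π * n) := by positivity
  have heq : (4 * π * n * |ψ| - U) ^ 2 / (4 * π * n) =
      4 * π * n * ψ ^ 2 + U ^ 2 / (4 * π * n) - 2 * |ψ| * U := by
    field_simp
    rw [← sq_abs ψ]
    ring
  linarith

/-- **Pointwise bound for the inertial integrand.** With `w = m P + r`, `m² = 2π²ψ²(1 + E)`,
`|m| ≤ 2π|ψ|`, `‖r‖ ≤ u`:
`⟪w, A w⟫ ≤ 2π² ψ² ⟪P,AP⟫ + 2π² ψ² ⟪P,AP⟫ E + 2π s ‖P‖ (4πn ψ² + u²/(4πn)) + s u²`. [folklore] -/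
theorem inner_packet_pointwise_le {E : Type*} [NormedAddCommGroup E] [InnerProductSpace ℝ E]
    (A : E →L[ℝ] E) {s : ℝ} (hs0 : 0 ≤ s) (hA : ∀ η : E, ‖η‖ = 1 → |inner ℝ η (A η)| ≤ s)
    {m ψ Er u n : ℝ} (hn : 0 < n) (P r : E)
    (hm_sq : m ^ 2 = 2 * π ^ 2 * ψ ^ 2 + 2 * π ^ 2 * ψ ^ 2 * Er) (hm_abs : |m| ≤ 2 * π * |ψ|)
    (hr : ‖r‖ ≤ u) :
    inner ℝ (m • P + r) (A (m • P + r)) ≤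
      2 * π ^ 2 * (ψ ^ 2 * inner ℝ P (A P)) + 2 * π ^ 2 * (ψ ^ 2 * inner ℝ P (A P) * Er) +
        2 * π * s * ‖P‖ * (4 * π * n * ψ ^ 2 + u ^ 2 / (4 * π * n)) + s * u ^ 2 := by
  have h1 := inner_map_add_le A hA m P r
  have h2 : m ^ 2 * inner ℝ P (A P) =
      2 * π ^ 2 * (ψ ^ 2 * inner ℝ P (A P)) + 2 * π ^ 2 * (ψ ^ 2 * inner ℝ P (A P) * Er) := by
    rw [hm_sq]; ring
  have hu0 : 0 ≤ u := (norm_nonneg r).trans hr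
  have ha := two_mul_abs_mul_le (ψ := ψ) (U := u) hn
  have hb : |m| * ‖r‖ ≤ 2 * π * |ψ| * u := mul_le_mul hm_abs hr (norm_nonneg _) (by positivity)
  have hsP : 0 ≤ s * ‖P‖ := mul_nonneg hs0 (norm_nonneg _)
  have h3 : 2 * s * |m| * ‖P‖ * ‖r‖ ≤ 2 * π * s * ‖P‖ * (4 * π * n * ψ ^ 2 + u ^ 2 / (4 * π * n)) :=
    calc 2 * s * |m| * ‖P‖ * ‖r‖ = 2 * (s * ‖P‖) * (|m| * ‖r‖) := by ring
      _ ≤ 2 * (s * ‖P‖) * (2 * π * |ψ| * u) := by gcongr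
      _ = 2 * π * (s * ‖P‖) * (2 * |ψ| * u) := by ring
      _ ≤ 2 * π * (s * ‖P‖) * (4 * π * n * ψ ^ 2 + u ^ 2 / (4 * π * n)) := by gcongr
      _ = 2 * π * s * ‖P‖ * (4 * π * n * ψ ^ 2 + u ^ 2 / (4 * π * n)) := by ring
  have h4 : s * ‖r‖ ^ 2 ≤ s * u ^ 2 := mul_le_mul_of_nonneg_left (pow_le_pow_left₀ (norm_nonneg _) hr 2) hs0
  linarith

/-- **Pointwise two-sided bound for the energy integrand** (same notation):
`2π²‖P‖²ψ² + 2π²‖P‖²ψ²E - 2π‖P‖(4πnψ² + u²/(4πn)) ≤ ‖w‖² ≤ (same) + 2·2π‖P‖(…) … + u²`. [folklore] -/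
theorem norm_packet_pointwise_bounds {E : Type*} [NormedAddCommGroup E] [InnerProductSpace ℝ E]
    {m ψ Er u n : ℝ} (hn : 0 < n) (P r : E)
    (hm_sq : m ^ 2 = 2 * π ^ 2 * ψ ^ 2 + 2 * π ^ 2 * ψ ^ 2 * Er) (hm_abs : |m| ≤ 2 * π * |ψ|)
    (hr : ‖r‖ ≤ u) :
    (2 * π ^ 2 * ‖P‖ ^ 2 * ψ ^ 2 + 2 * π ^ 2 * ‖P‖ ^ 2 * (ψ ^ 2 * Er) -
        2 * π * ‖P‖ * (4 * π * n * ψ ^ 2 + u ^ 2 / (4 * π * n)) ≤ ‖m • P + r‖ ^ 2) ∧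
      (‖m • P + r‖ ^ 2 ≤ 2 * π ^ 2 * ‖P‖ ^ 2 * ψ ^ 2 + 2 * π ^ 2 * ‖P‖ ^ 2 * (ψ ^ 2 * Er) +
        2 * π * ‖P‖ * (4 * π * n * ψ ^ 2 + u ^ 2 / (4 * π * n)) + u ^ 2) := by
  have h1 := norm_smul_add_sq_bounds m P r
  have h2 : m ^ 2 * ‖P‖ ^ 2 = 2 * π ^ 2 * ‖P‖ ^ 2 * ψ ^ 2 + 2 * π ^ 2 * ‖P‖ ^ 2 * (ψ ^ 2 * Er) := by
    rw [hm_sq]; ring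
  have hu0 : 0 ≤ u := (norm_nonneg r).trans hr
  have ha := two_mul_abs_mul_le (ψ := ψ) (U := u) hn
  have hb : |m| * ‖r‖ ≤ 2 * π * |ψ| * u := mul_le_mul hm_abs hr (norm_nonneg _) (by positivity)
  have h3 : 2 * |m| * ‖P‖ * ‖r‖ ≤ 2 * π * ‖P‖ * (4 * π * n * ψ ^ 2 + u ^ 2 / (4 * π * n)) :=
    calc 2 * |m| * ‖P‖ * ‖r‖ = 2 * ‖P‖ * (|m| * ‖r‖) := by ring
      _ ≤ 2 * ‖P‖ * (2 * π * |ψ| * u) := by gcongr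
      _ = 2 * π * ‖P‖ * (2 * |ψ| * u) := by ring
      _ ≤ 2 * π * ‖P‖ * (4 * π * n * ψ ^ 2 + u ^ 2 / (4 * π * n)) := by gcongr
  have h4 : ‖r‖ ^ 2 ≤ u ^ 2 := pow_le_pow_left₀ (norm_nonneg _) hr 2
  constructor <;> linarith [h1.1, h1.2]

/-- **The oscillatory integrals vanish**: if `ψ = ∑_{Ω_M} α_k e_k` (real) and `G` (real) has
spectrum in `Ω_D`, and `|2pᵢ| > 2M + D` for some `i`, then `∫ ψ² G Re(e_p²) = 0` and
`∫ ψ² Re(e_p²) = 0`. [folklore] -/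
theorem integral_envelope_sq_oscillatory_eq_zero {M D : ℕ} {ψ G : UnitAddTorus (Fin 3) → ℝ}
    (hψ : ∃ c₀ : (Fin 3 → ℤ) → ℂ, (fun x => ((ψ x : ℝ) : ℂ)) = trigPoly (freqCube M) c₀)
    (hG : ∃ c₀ : (Fin 3 → ℤ) → ℂ, (fun x => ((G x : ℝ) : ℂ)) = trigPoly (freqCube D) c₀)
    {p : Fin 3 → ℤ} (hp : ∃ i, ((2 * M + D : ℕ) : ℤ) < |2 * p i|) :
    ∫ x, ψ x ^ 2 * G x * ((mFourier p x) ^ 2).re = 0 ∧ ∫ x, ψ x ^ 2 * ((mFourier p x) ^ 2).re = 0 := by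
  classical
  have h2p : ∃ i, ((2 * M + D : ℕ) : ℤ) < |(p + p) i| := by
    obtain ⟨i, hi⟩ := hp; exact ⟨i, by rw [Pi.add_apply, ← two_mul]; exact hi⟩
  have hcubes : freqCube (d := Fin 3) M + freqCube M + freqCube D ⊆ freqCube (2 * M + D) :=
    (Finset.add_subset_add (freqCube_add_subset M M) subset_rfl).trans
      ((freqCube_add_subset _ _).trans (by rw [two_mul]))
  have h0 := zero_not_mem_freqCube_add_singleton (d := Fin 3) h2p
  constructor
  · have hspec : ∃ c₀ : (Fin 3 → ℤ) → ℂ, (fun x => ((ψ x : ℝ) : ℂ) * ((ψ x : ℝ) : ℂ) * ((G x : ℝ) : ℂ) *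
        mFourier (p + p) x) = trigPoly (freqCube (2 * M + D) + {p + p}) c₀ :=
      spec_mul_mFourier (spec_mono (spec_mul (spec_mul hψ hψ) hG) hcubes) (p + p)
    have hint := spec_integral_eq_zero hspec h0
    have hre : ∀ x, ψ x ^ 2 * G x * ((mFourier p x) ^ 2).re =
        (((ψ x : ℝ) : ℂ) * ((ψ x : ℝ) : ℂ) * ((G x : ℝ) : ℂ) * mFourier (p + p) x).re := fun x => by
      rw [mFourier_add, ← Complex.ofReal_mul, ← Complex.ofReal_mul, Complex.re_ofReal_mul, pow_two,
        pow_two]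
    simp_rw [hre]
    have hI : Integrable (fun x => ((ψ x : ℝ) : ℂ) * ((ψ x : ℝ) : ℂ) * ((G x : ℝ) : ℂ) *
        mFourier (p + p) x) volume := by
      obtain ⟨c₀, hc₀⟩ := hspec
      rw [hc₀]; exact (continuous_trigPoly _ _).integrable_unitAddTorus
    have := integral_re hI
    rw [hint] at this
    simpa using this
  · have hspec : ∃ c₀ : (Fin 3 → ℤ) → ℂ, (fun x => ((ψ x : ℝ) : ℂ) * ((ψ x : ℝ) : ℂ) * mFourier (p + p) x) =
        trigPoly (freqCube (2 * M + D) + {p + p}) c₀ := by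
      refine spec_mul_mFourier (spec_mono (spec_mul hψ hψ) ?_) (p + p)
      exact (freqCube_add_subset M M).trans (freqCube_mono (by omega))
    have hint := spec_integral_eq_zero hspec h0
    have hre : ∀ x, ψ x ^ 2 * ((mFourier p x) ^ 2).re =
        (((ψ x : ℝ) : ℂ) * ((ψ x : ℝ) : ℂ) * mFourier (p + p) x).re := fun x => by
      rw [mFourier_add, ← Complex.ofReal_mul, Complex.re_ofReal_mul, pow_two, pow_two]
    simp_rw [hre]
    have hI : Integrable (fun x => ((ψ x : ℝ) : ℂ) * ((ψ x : ℝ) : ℂ) * mFourier (p + p) x) volume := by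
      obtain ⟨c₀, hc₀⟩ := hspec
      rw [hc₀]; exact (continuous_trigPoly _ _).integrable_unitAddTorus
    have := integral_re hI
    rw [hint] at this
    simpa using this

end Summit.AnomalousDissipation.AnomalousDissipation.Theorems
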